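import Summits.Ventures.Crystal3D.Theorems.StickyWulffConstantGenericWallFloorTubeWalkSF
import Summits.Ventures.Crystal3D.Theorems.StickyWulffConstantGenericWallFloorSealing
import HarnessLib

/-!
# Every tube of the cell contains an unsaturated ball (sliver-free version)

HONEST FRAMING. Venture `Summits/Ventures/Crystal3D` (cell `crystal3d-full`), helper for the crux
`GenericWallFloor` (stmt-Ventures-19480) of `route-Ventures-StickyWulffConstant`, REGISTERED line `WallLedgerG`,
open stub `stub_twoSlabAdhesion` (general fillings; ARCH v4 «coherent walks in tubes», assembly step (A2)).
Rung credit only; F-C1 not moved.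

`tube_has_payer`: in the two-slab cell (bottom window `P₁` complete on `Λ₁ = A₁·Λ₀ + t₁` at heights
`[−2R₀, −R₀]`, top window `P₂` complete on `Λ₂` at heights `[h + R₀, h + 2R₀]`, clean top sliver), for a frame
set `𝓕 ∋ A₁` closed under `{111}` mirrors and avoiding `A₂(Λ₀)` (non-chain pair), EVERY vertical axis
`(p₀, p₁)` with `p₀² + p₁² ≤ (ρ − 20)²` has a ball `z ∈ X` with at most eleven contacts, within horizontal
distance `18` of the axis and at height in `[−R₀ − 2, h + R₀ + 3]` (off the clamped face layers).  Proof: the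
covering radius of `Λ₁` (`movedFcc_exists_near_below`) gives a start ball of `P₁` under the axis near height
`−R₀`, its three independent DOWN slots are window balls (hemisphere lemma), and `tube_walk_pays_height` runs
the steered coherent walk.
WHAT THIS IS NOT: not the stub; the grid count and the ledger bookkeeping remain; F-C1 not moved.
-/

noncomputable section

namespace Summit.Ventures.Crystal3D.Theorems

open Summit.Ventures.Crystal3D Finset
open Literature.MathematicalPhysics.StatisticalMechanics (fccStacking)
open scoped InnerProductSpace

/-- **Every tube pays.**  See the module docstring. -/
theorem tube_has_payer_sf {δ : ℝ} (hg : KissingGap δ) (hc : KissingClassification δ)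
    (X : Finset (EuclideanSpace ℝ (Fin 3))) (hX : ∀ p ∈ X, ∀ q ∈ X, p ≠ q → 1 ≤ dist p q)
    (A₁ : EuclideanSpace ℝ (Fin 3) ≃ₗᵢ[ℝ] EuclideanSpace ℝ (Fin 3)) (t₁ : EuclideanSpace ℝ (Fin 3))
    (A₂ : EuclideanSpace ℝ (Fin 3) ≃ₗᵢ[ℝ] EuclideanSpace ℝ (Fin 3)) (t₂ : EuclideanSpace ℝ (Fin 3))
    (P₁ P₂ : Finset (EuclideanSpace ℝ (Fin 3))) (R₀ h ρ : ℝ) (hR₀ : 3 ≤ R₀) (hρ : R₀ ≤ ρ) (hρ20 : 20 ≤ ρ)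
    (hh : 0 ≤ h) (hP₁X : P₁ ⊆ X) (hP₂X : P₂ ⊆ X) (hcell : ∀ p ∈ X, p 2 ≤ h + 2 * R₀)
    (hP₁ : ∀ p, p ∈ P₁ ↔ (p ∈ (fun q => A₁ q + t₁) '' fccStacking 1 (Real.sqrt (2 / 3)) ∧
      -(2 * R₀) ≤ p 2 ∧ p 2 ≤ -R₀ ∧ p 0 ^ 2 + p 1 ^ 2 ≤ ρ ^ 2))
    (hP₂ : ∀ p, p ∈ P₂ ↔ (p ∈ (fun q => A₂ q + t₂) '' fccStacking 1 (Real.sqrt (2 / 3)) ∧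
      h + R₀ ≤ p 2 ∧ p 2 ≤ h + 2 * R₀ ∧ p 0 ^ 2 + p 1 ^ 2 ≤ ρ ^ 2))
    (𝓕 : Set (EuclideanSpace ℝ (Fin 3) ≃ₗᵢ[ℝ] EuclideanSpace ℝ (Fin 3))) (hA₁ : A₁ ∈ 𝓕)
    (havoid : ∀ G ∈ 𝓕, G '' fccStacking 1 (Real.sqrt (2 / 3)) ≠ A₂ '' fccStacking 1 (Real.sqrt (2 / 3)))
    (hclosed : ∀ G ∈ 𝓕, ∀ m : EuclideanSpace ℝ (Fin 3), ‖m‖ = 1 →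
      (∀ w ∈ fccSlots, ⟪G w, m⟫_ℝ = 0 ∨ ⟪G w, m⟫_ℝ = Real.sqrt (2 / 3) ∨ ⟪G w, m⟫_ℝ = -Real.sqrt (2 / 3)) →
      ∀ G' : EuclideanSpace ℝ (Fin 3) ≃ₗᵢ[ℝ] EuclideanSpace ℝ (Fin 3),
        (∀ x, G' x = G x - (2 * ⟪G x, m⟫_ℝ) • m) → G' ∈ 𝓕)
    (p0 p1 : ℝ) (hp : p0 ^ 2 + p1 ^ 2 ≤ (ρ - 20) ^ 2) :
    ∃ z ∈ X, (X.filter fun q => dist z q = 1).card ≤ 11 ∧ (z 0 - p0) ^ 2 + (z 1 - p1) ^ 2 ≤ 18 ^ 2 ∧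
      -R₀ - 2 ≤ z 2 ∧ z 2 ≤ h + R₀ + 3 := by
  set Λ₁ : Set (EuclideanSpace ℝ (Fin 3)) := (fun q => A₁ q + t₁) '' fccStacking 1 (Real.sqrt (2 / 3)) with hΛ₁
  set e₃ : EuclideanSpace ℝ (Fin 3) := EuclideanSpace.single (2 : Fin 3) (1 : ℝ) with he₃
  have he₃i : ∀ d : EuclideanSpace ℝ (Fin 3), ⟪d, e₃⟫_ℝ = d 2 := fun d => by
    rw [he₃, EuclideanSpace.inner_single_right]; simp
  have he₃0 : e₃ ≠ 0 := by
    intro h0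
    have : ‖e₃‖ = 1 := by rw [he₃, PiLp.norm_single, norm_one]
    rw [h0, norm_zero] at this; norm_num at this
  -- the axis point at height `−R₀`
  set qpt : EuclideanSpace ℝ (Fin 3) := EuclideanSpace.single (0 : Fin 3) p0 + EuclideanSpace.single (1 : Fin 3) p1 +
    EuclideanSpace.single (2 : Fin 3) (-R₀) with hqpt
  have hq0 : qpt 0 = p0 := by simp [hqpt]
  have hq1 : qpt 1 = p1 := by simp [hqpt]
  have hq2 : qpt 2 = -R₀ := by simp [hqpt]
  -- a start ball of `Λ₁` within distance `< 1` of it and not higher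
  obtain ⟨x₀, hx₀Λ, hdx, hx₀2⟩ : ∃ x₀ ∈ Λ₁, dist qpt x₀ < 1 ∧ x₀ 2 ≤ -R₀ := by
    by_cases hq : qpt ∈ Λ₁
    · exact ⟨qpt, hq, by rw [dist_self]; norm_num, by rw [hq2]⟩
    · obtain ⟨v, hv, hd, hl⟩ := movedFcc_exists_near_below A₁ t₁ qpt hq
      exact ⟨v, hv, hd, by rw [hq2] at hl; exact hl⟩
  -- coordinates of `x₀` relative to the axis
  have hcoord : ∀ i : Fin 3, |x₀ i - qpt i| ≤ dist qpt x₀ := fun i => by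
    rw [dist_comm]; exact abs_apply_sub_le_dist x₀ qpt i
  have hx₀2' : -R₀ - 1 < x₀ 2 := by
    have := (abs_le.1 (hcoord 2)).1; rw [hq2] at this; linarith
  have hx₀h : (x₀ 0 - p0) ^ 2 + (x₀ 1 - p1) ^ 2 ≤ 1 ^ 2 := by
    have hn := norm_sq_eq_fin3 (x₀ - qpt)
    have hd1 : ‖x₀ - qpt‖ ^ 2 ≤ 1 := by
      rw [← dist_eq_norm, dist_comm]; nlinarith [dist_nonneg (x := qpt) (y := x₀)]
    simp only [PiLp.sub_apply, hq0, hq1] at hn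
    nlinarith [sq_nonneg ((x₀ - qpt) 2)]
  -- window membership of points of `Λ₁` near the axis at the right heights
  have hρ1 : (0 : ℝ) ≤ ρ - 20 := by linarith
  have inP₁ : ∀ v ∈ Λ₁, -(2 * R₀) ≤ v 2 → v 2 ≤ -R₀ → (v 0 - p0) ^ 2 + (v 1 - p1) ^ 2 ≤ 2 ^ 2 → v ∈ X := by
    intro v hv h1 h2 h3
    apply hP₁X
    rw [hP₁]
    refine ⟨hv, h1, h2, ?_⟩
    have := sq2_add_le hρ1 (by norm_num : (0 : ℝ) ≤ 2) hp h3
    have e0 : v 0 = p0 + (v 0 - p0) := by ring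
    have e1 : v 1 = p1 + (v 1 - p1) := by ring
    rw [e0, e1]; nlinarith
  have hx₀X : x₀ ∈ X := inP₁ x₀ hx₀Λ (by linarith) hx₀2 (by linarith)
  -- three independent down slots, all window balls
  obtain ⟨a, ha, b, hb, c, hc', ha', hb', hc'', hind⟩ := exists_independent_slots_of_hemisphere A₁ he₃0
  have down : ∀ {w}, w ∈ fccSlots → ⟪A₁ w, e₃⟫_ℝ < 0 → x₀ + A₁ w ∈ X := by
    intro w hw hneg
    rw [he₃i] at hneg
    have hw1 : ‖A₁ w‖ = 1 := by rw [LinearIsometryEquiv.norm_map, norm_eq_one_of_mem_fccSlots hw]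
    have hwn := norm_sq_eq_fin3 (A₁ w)
    rw [hw1, one_pow] at hwn
    have hw2 : -1 ≤ (A₁ w) 2 := by nlinarith [sq_nonneg ((A₁ w) 0), sq_nonneg ((A₁ w) 1), sq_nonneg ((A₁ w) 2 + 1)]
    have hwh : (A₁ w) 0 ^ 2 + (A₁ w) 1 ^ 2 ≤ 1 ^ 2 := by nlinarith [sq_nonneg ((A₁ w) 2)]
    apply inP₁ _ (movedFcc_add_site_mem A₁ t₁ hx₀Λ (mem_fcc_of_mem_fccSlots hw))
    · simp only [PiLp.add_apply]; linarith
    · simp only [PiLp.add_apply]; linarith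
    · have := sq2_add_le (by norm_num : (0 : ℝ) ≤ 1) (by norm_num : (0 : ℝ) ≤ 1) hx₀h hwh
      simp only [PiLp.add_apply]
      have e0 : x₀ 0 + (A₁ w) 0 - p0 = (x₀ 0 - p0) + (A₁ w) 0 := by ring
      have e1 : x₀ 1 + (A₁ w) 1 - p1 = (x₀ 1 - p1) + (A₁ w) 1 := by ring
      rw [e0, e1]; linarith
  -- run the walk
  obtain ⟨z, hz, hdeg, hzh, hz1, hz2⟩ := tube_walk_pays_sf hg hc X hX A₂ t₂ P₂ R₀ h ρ hR₀ hρ hρ20 hP₂X hcell hP₂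
    𝓕 havoid hclosed p0 p1 hp ⌈(h + 3 * R₀ + 3) * 32⌉₊ x₀ A₁ a b c hx₀X hA₁ ha hb hc' hind
    (down ha ha') (down hb hb') (down hc' hc'') (by linarith) (by linarith)
    (by
      have h1 : (h + 2 * R₀ + 2 - x₀ 2) * 32 ≤ (h + 3 * R₀ + 3) * 32 := by nlinarith
      exact h1.trans (Nat.le_ceil _))
  exact ⟨z, hz, hdeg, hzh, by linarith, hz2⟩

end Summit.Ventures.Crystal3D.Theorems

end
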